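import Mathlib.Analysis.Calculus.FDeriv.Comp
import Mathlib.Analysis.Calculus.Deriv.Comp
import Mathlib.Analysis.Calculus.MeanValue
import Mathlib.MeasureTheory.Integral.IntervalIntegral.FundThmCalculus
import HarnessLib

/-!
# A mixed chain rule for flows: `d/ds Φ(s, z(s)) = ∂_sΦ(s, z(s)) + D_yΦ(s,·)(z(s)) z'(s)` without joint `C¹`

Helper file for crux K1L `LagrangianRenormalisationStep` (stmt-AnomalousDissipation-24912), `stub_tailL` plan rev 2 (evidence #32), input (i) of
the flow decomposition `X_m = X_{m−1} ∘ G ∘ Y_m ∘ G⁻¹`: the Lagrangian flows of the tree are known to be `C¹` in time for each point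
(`IsFlow` + fundamental theorem of calculus, derivative `b_{≤m}(s, X)` JOINTLY CONTINUOUS) and smooth in space for each time
(`LevelRegular.isSmooth_disp`), but not jointly `C¹`.  That is enough for the chain rule along a differentiable curve `z`:
`F(s) = Φ s (z s)` has derivative `W s₀ (z s₀) + A (z' s₀)` at `s₀` whenever `∂_s Φ(s, y) = W s y` for all `(s, y)` with `W` jointly
continuous, `Φ s₀` has Fréchet derivative `A` at `z s₀`, and `z` has derivative `z'` at `s₀` (`hasDerivAt_comp_curve`).  Proof: split
`Φ(s, z s) − Φ(s₀, z s₀) = [Φ(s, z s) − Φ(s₀, z s)] + [Φ(s₀, z s) − Φ(s₀, z s₀)]`; the first bracket is `∫_{s₀}^s W(r, z s) dr` (FTC at the frozen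
point), whose difference from `(s − s₀) W(s₀, z s₀)` is `o(s − s₀)` by joint continuity; the second is the ordinary chain rule.
Pure real analysis; no definitions, no named facts, no sorry.  Prover seat `ad-solenoidal-k2r-lowerlaw-p1` g5, 2026-08-28.
-/

set_option linter.dupNamespace false

noncomputable section

namespace Summit.AnomalousDissipation.AnomalousDissipation.Theorems.SolenoidalFractalHomogenisation.LagrangianCarrier

open Set Filter Topology MeasureTheory intervalIntegral Metric

variable {E F : Type*} [NormedAddCommGroup E] [NormedAddCommGroup F] [NormedSpace ℝ F]

/-- **Frozen-point estimate**: if `∂_sΦ(s, y) = W s y` everywhere with `W` jointly continuous at `(s₀, y₀)` (and continuous in `s` for each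
`y`), then `Φ(s, y) − Φ(s₀, y) − (s − s₀) • W(s₀, y₀)` is small: for every `ε > 0` there is `δ > 0` with
`‖Φ s y − Φ s₀ y − (s − s₀) • W s₀ y₀‖ ≤ ε |s − s₀|` whenever `|s − s₀| < δ` and `‖y − y₀‖ < δ` (mean value inequality). [folklore] -/
theorem norm_sub_sub_smul_le_of_hasDerivAt {Φ W : ℝ → E → F} (hΦ : ∀ y s, HasDerivAt (fun s => Φ s y) (W s y) s)
    {s₀ : ℝ} {y₀ : E} (hW : ContinuousAt (fun p : ℝ × E => W p.1 p.2) (s₀, y₀)) {ε : ℝ} (hε : 0 < ε) :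
    ∃ δ > 0, ∀ s y, |s - s₀| < δ → ‖y - y₀‖ < δ → ‖Φ s y - Φ s₀ y - (s - s₀) • W s₀ y₀‖ ≤ ε * |s - s₀| := by
  -- joint continuity of `W` at `(s₀, y₀)`
  obtain ⟨δ, hδ, hWδ⟩ : ∃ δ > 0, ∀ s y, |s - s₀| < δ → ‖y - y₀‖ < δ → ‖W s y - W s₀ y₀‖ ≤ ε := by
    have h := Metric.continuousAt_iff.1 hW ε hε
    obtain ⟨δ, hδ, h⟩ := h
    refine ⟨δ, hδ, fun s y hs hy => le_of_lt ?_⟩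
    have hd : dist (s, y) (s₀, y₀) < δ := by
      rw [Prod.dist_eq, max_lt_iff]
      exact ⟨by rwa [Real.dist_eq], by rwa [dist_eq_norm]⟩
    simpa [dist_eq_norm] using h hd
  refine ⟨δ, hδ, fun s y hs hy => ?_⟩
  -- mean value inequality for `g r = Φ r y − r • W s₀ y₀` on the segment between `s₀` and `s`
  have hg : ∀ r ∈ Set.uIcc s₀ s, HasDerivWithinAt (fun r => Φ r y - r • W s₀ y₀) (W r y - W s₀ y₀) (Set.uIcc s₀ s) r :=
    fun r _ => ((hΦ y r).sub ((hasDerivAt_id r).smul_const (W s₀ y₀))).hasDerivWithinAt |>.congr_deriv (by simp)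
  have hbound : ∀ r ∈ Set.uIcc s₀ s, ‖W r y - W s₀ y₀‖ ≤ ε := by
    intro r hr
    refine hWδ r y (lt_of_le_of_lt ?_ hs) hy
    exact Set.abs_sub_left_of_mem_uIcc hr
  have hmv := (convex_uIcc s₀ s).norm_image_sub_le_of_norm_hasDerivWithin_le hg hbound
    (Set.left_mem_uIcc) (Set.right_mem_uIcc)
  have e : Φ s y - Φ s₀ y - (s - s₀) • W s₀ y₀ = (Φ s y - s • W s₀ y₀) - (Φ s₀ y - s₀ • W s₀ y₀) := by
    rw [sub_smul]; abel
  rw [e]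
  calc ‖(Φ s y - s • W s₀ y₀) - (Φ s₀ y - s₀ • W s₀ y₀)‖ ≤ ε * ‖s - s₀‖ := hmv
    _ = ε * |s - s₀| := by rw [Real.norm_eq_abs]

/-- **Mixed chain rule along a curve** (no joint `C¹` needed): if `∂_sΦ(s,y) = W s y` for all `(s,y)`, `W` is jointly continuous at
`(s₀, z s₀)`, `Φ s₀` has Fréchet derivative `A` at `z s₀` and `z` has derivative `z'` at `s₀`, then `s ↦ Φ s (z s)` has derivative
`W s₀ (z s₀) + A z'` at `s₀`. [folklore] -/
theorem hasDerivAt_comp_curve [NormedSpace ℝ E] {Φ W : ℝ → E → F} (hΦ : ∀ y s, HasDerivAt (fun s => Φ s y) (W s y) s)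
    {s₀ : ℝ} {z : ℝ → E} {z' : E} (hz : HasDerivAt z z' s₀)
    (hW : ContinuousAt (fun p : ℝ × E => W p.1 p.2) (s₀, z s₀))
    {A : E →L[ℝ] F} (hA : HasFDerivAt (Φ s₀) A (z s₀)) :
    HasDerivAt (fun s => Φ s (z s)) (W s₀ (z s₀) + A z') s₀ := by
  have h2 : HasDerivAt (fun s => Φ s₀ (z s)) (A z') s₀ := hA.comp_hasDerivAt s₀ hz
  rw [hasDerivAt_iff_isLittleO, Asymptotics.isLittleO_iff] at h2 ⊢
  intro ε hε
  obtain ⟨δ, hδ, hfrozen⟩ := norm_sub_sub_smul_le_of_hasDerivAt hΦ hW (half_pos hε)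
  have hzc : ContinuousAt z s₀ := hz.continuousAt
  have hev1 : ∀ᶠ s in 𝓝 s₀, |s - s₀| < δ := by
    filter_upwards [Metric.ball_mem_nhds s₀ hδ] with s hs
    rwa [Metric.mem_ball, Real.dist_eq] at hs
  have hev2 : ∀ᶠ s in 𝓝 s₀, ‖z s - z s₀‖ < δ := by
    filter_upwards [(Metric.tendsto_nhds.1 hzc) δ hδ] with s hs
    rwa [dist_eq_norm] at hs
  filter_upwards [hev1, hev2, h2 (half_pos hε)] with s hs1 hs2 hs3
  have e : Φ s (z s) - Φ s₀ (z s₀) - (s - s₀) • (W s₀ (z s₀) + A z') =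
      (Φ s (z s) - Φ s₀ (z s) - (s - s₀) • W s₀ (z s₀)) + (Φ s₀ (z s) - Φ s₀ (z s₀) - (s - s₀) • A z') := by
    rw [smul_add]; abel
  rw [e]
  calc ‖(Φ s (z s) - Φ s₀ (z s) - (s - s₀) • W s₀ (z s₀)) + (Φ s₀ (z s) - Φ s₀ (z s₀) - (s - s₀) • A z')‖
      ≤ ‖Φ s (z s) - Φ s₀ (z s) - (s - s₀) • W s₀ (z s₀)‖ + ‖Φ s₀ (z s) - Φ s₀ (z s₀) - (s - s₀) • A z'‖ := norm_add_le _ _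
    _ ≤ ε / 2 * |s - s₀| + ε / 2 * ‖s - s₀‖ := add_le_add (hfrozen s (z s) hs1 hs2) hs3
    _ = ε * ‖s - s₀‖ := by rw [Real.norm_eq_abs]; ring

end Summit.AnomalousDissipation.AnomalousDissipation.Theorems.SolenoidalFractalHomogenisation.LagrangianCarrier

end
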